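import Literature.MathematicalPhysics.QuantumFieldTheory.Balaban1983to89.Node00.Record5
import Literature.MathematicalPhysics.QuantumFieldTheory.Balaban1983to89.B16NodeKnit
import Literature.MathematicalPhysics.QuantumFieldTheory.Balaban1983to89.B14NodeKnitRecord5

/-!
# `Balaban1983to89.B16NodeKnitRecord5` — YM-DAG node N13 · [Balaban1989LargeFieldII] CMP **122** (1989) 355–392, Theorem 1 p. 355 + (0.1),
# Cor. 3 pp. 387 ∕ 391: the N13 knit AT NODE 00's STAGE-5 RECORD `Node00.IsRecordOfRecord₅ F N D w` — both product slots READ AT THE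
# RECORD'S OBJECTS, the `S_N13 Rec₅` shape, and the design-E shape `S_N13E Rec₅` ([III] Cor. 3's exponents existential at the datum)

statement-level bookkeeping over published theorems with citation tags; kernel-checked compositions of tree theorems;
nothing here is a claim about the Yang–Mills mass gap.

CITATION HEADER (lean-in-tree rule).  Source: T. Bałaban, *Large field renormalization. II. Localization, exponentiation, and bounds for the
𝐑 operation*, Commun. Math. Phys. **122**, 355–392 (1989), doi:10.1007/bf01238433 [Balaban1989LargeFieldII] (cell paper B16 = «[V]»), with
T. Bałaban, *Convergent renormalization expansions for lattice gauge theories*, Commun. Math. Phys. **119**, 243–285 (1988) [Balaban1988Convergent]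
(«[III]»: the assumed 𝐑 of p. 244 and Cor. 3 (2.50) p. 264).  Seat `pub-ymgap-dag-n13-a` (YM-PLAN Track A, HUMAN RULING D-0062: the KNIT-BY-NAME
seat of node N13; chair R420 ∕ R422 ∕ R424; director-ym LINE №12), module 5 of the seat (modules 1–4: `B16NodeKnit`, `B16NodeKnitContract`,
`B16NodeKnitNonVacuity`, `B16NodeKnitExponents`).  BY NAME and UNCHANGED: `…Node00.Record5` (seat pub-ymgap-node00-def g28: `IsRecordOfRecord₅`,
`Stage5Params`, `Residual₅`, `machineOfRecord₅`, `densOfRecord₅`, `datumOfRecord₅`, `upOfRecord₅`, `rho_datumOfRecord₅`), `…B16NodeKnit`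
(`uvSlot_of_cor3Leaves`), `…B14NodeKnitRecord5` (seat dag-n11-a, the N11 knit at the same record — pattern of this file; its two unfoldings
`rOperation_iff_rOpLeaf_res` ∕ `densitiesDescribed_iff_S218` are node-independent and REUSED here by name),
`…B14Cor3` (`TermData`, `ReprFamily`, `LeafH ∕ U1 ∕ U2 ∕ L1 ∕ L2`), `…Node00.DatumAvLayer` (`cfgOfRecord`, `SU`), `…Dag` (`B16_main` :253),
`…DagBinding` (`leavesP`, `ROpLeaf`, `WorldP`).

WHAT THE STAGE-5 RECORD PINS FOR N13 AND WHAT IT LEAVES.  At a record `(D, w)` with parameters `θ : Node00.Stage5Params F N`: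
`w.C = D.C = (datumOfRecord₅ θ).C = (machineOfRecord₅ θ).construction (avOfRecord F N)` and `w.up P = upOfRecord₅ θ P` (the N-binding over the
Stage-3 carriers of record and the RESIDUAL run-indexed carrier families).  Hence N13's two OWN products read, at the run `P`:
* the R-slot `(leavesP w P).rOperation` IS `DagBinding.ROpLeaf (θ.res.V P)` — [III] p. 244's assumed property for the RESIDUAL 𝐑-carrier `θ.res.V P`
  (free data of `Residual₅`; NODE 00 Stage 7, seat pub-ymgap-node00-def-R, builds it from `θ.res.R` and the format spaces) —
  `B14NodeKnitRecord5.rOperation_iff_rOpLeaf_res`;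
* the Cor.-3 slot «(interval ⇒ §2 description) ⇒ (interval ⇒ (2.50) with `e∓(g_k)`)» reads: the interval hypothesis on the FORWARD-GENERATED couplings
  `genSeq θ.res.βfun P.g0 k` in `]0, w.γ]` (`w.γ = θ.γ`); the §2-description guard `θ.res.S218 P k (ρ_k)` at the DETERMINED densities of record
  `ρ_k = densOfRecord₅ θ P k` (`ρ₀` = the Wilson start of record, `ρ_{k+1} = θ.res.R P k (TrhoOfRecord F N P.K k ρ_k)`); and the two-sided inequality
  `θ.res.χ P k U · exp[−g_k⁻²·θ.res.wilsonBG P k U − w.em(g_k)·|T₁^{(k)}|] ≤ ρ_k U ≤ exp[w.ep(g_k)·|T₁^{(k)}|]` on every gauge field `U` of `T^{(k)}` of the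
  `K`-th torus, `|T₁^{(k)}| = Fintype.card (Site (F.P P.K) k)` — `uvBounds_iff_densOfRecord₅`.  The exponent FUNCTIONS `w.em, w.ep` stay world letters
  (the record predicate does not read them; [III] Cor. 3: *"constants E₋, E₊ … depending on g_k"*).
So over Stage 5 the knit keeps its two displayed slots, now LOCATED at the record's objects: (R₅) `ROpLeaf (θ.res.V P)` — [Balaban1989LargeFieldII] Thm 1's
delivery (pp. 356–391 with [IV]), a hypothesis; (UV₅) the Cor.-3 slot at the densities of record — p. 387 *"This implies the inequality (2.50) [III], hence
Corollary 3."*, a hypothesis, reducible BY NAME to the five typed leaves of [III] p. 264 (`B14Cor3`) at `(D.C, w.γ, w.em, w.ep)` or to per-step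
representation data at the densities of record.

WHAT THIS FILE PROVES (0 `sorry`, 0 `def`, standard axioms).
§0 `b16_main_of_rOperation_of_uvSlot` — N13 at ANY world and run from its two own products (binding-agnostic in `w.up`; the form both the N-binding
   record `IsRecordOfRecord₅` and the C-binding record of record `IsRecordOfRecord₅C` (staged) instantiate, since they differ in the `b10` leaf only).
§1 At the Stage-5 parameters `θ` (a world bound to `datumOfRecord₅ θ`): `smallCouplings_iff_genFlow`, `uvBounds_iff_densOfRecord₅`, `uvSlot_iff_atRecord₅`
   (the Cor.-3 slot unfolded at the record's objects); **`b16_main_at_stage5Params`** (N13 at `(w, P)` from (R₅) + (UV₅) read at the objects);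
   `b16_main_at_stage5Params_of_termData` ((UV₅) from per-step (2.18)-representation data at `ρ_k` of record, guard `S218`);
   `b16_main_at_stage5Params_of_cor3Leaves` ((UV₅) from a `B14Cor3.ReprFamily` of `(datumOfRecord₅ θ).C` and the five leaves at `(w.γ, w.em, w.ep)`).
§2 **`b16_main_of_isRecordOfRecord₅`** — THE KNIT AT THE RECORD PREDICATE (slots over the parameters of the record); `b16_main_forall_isRecordOfRecord₅` — the
   `S_N13 Rec₅` shape `∀ D w, IsRecordOfRecord₅ F N D w → ∀ P, Dag.B16_main (leavesP w P)` from the slots stated ONCE over all admissible `θ` at the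
   constant-binding worlds; `…_of_cor3Leaves` twins.
§3 DESIGN E (the dagwriter's `S_N13E`, plan g60 ∕ chair R430: [III] Cor. 3's exponents chosen AFTER the datum, BEFORE the world and the run):
   `isRecordOfRecord₅_reExp` ∕ `isRecordOfRecord₅_withGamma` (with `densOfRecord₅_withGamma`, `datumOfRecord₅_withGamma`, `upOfRecord₅_withGamma`: the record
   predicate reads neither `w.em, w.ep` NOR the value of `w.γ` given `D` — `θ.γ` is not read by `datumOfRecord₅ ∕ upOfRecord₅`; kernel facts for the planners:
   over one datum the record worlds carry EVERY `γ > 0`); **`s_N13E_shape_of_slots₅`**: `∀ D, (∃ w, Rec₅ D w) → ∃ e₋ e₊, ∀ w, Rec₅ D w → w.em = e₋ → w.ep = e₊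
   → ∀ P, N13` from datum-indexed exponent families `e∓ D`, the R-slot, and the five Cor.-3 leaves at `(D.C, γ, e₋ D, e₊ D)` for every parameter `θ` of `D`
   and every `γ`; `s_N13E_shape_of_slots₅_gamma` (the variant with `γ` chosen at the datum too); `b16_main_reExp_of_isRecordOfRecord₅` (one re-lettered world).

HONEST FRAMING.  A count-neutral SLOT landing (R429 (4)(i)): N13 is NOT discharged — (R₅) = [Balaban1989LargeFieldII] Thm 1 for 𝐑 at the objects of
record and (UV₅) = Cor. 3 at the densities of record are displayed hypotheses, statable in closed form once Stages 6–8 replace the residual fields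
(`S218`, `R`, `χ`, `wilsonBG`, `βfun`); nothing of Bałaban's is asserted or proved here; one finite four-torus programme at fixed `ε`, Bałaban AS PRINTED
with locators; nothing continuum ∕ ℝ⁴ ∕ OS ∕ mass gap ∕ Clay.
-/

noncomputable section

namespace Literature.MathematicalPhysics.QuantumFieldTheory.Balaban1983to89.B16NodeKnitRecord5

open DagBinding T4DatumAssembly T4Continuum Node00 FlowStepRuns

/-! ## §0. N13 from its two own products at any world (binding-agnostic) -/

/-- **N13 at any world and run from its two OWN products**: the `rOperation` leaf of `w.up P` (whatever the binding) and the Cor.-3 slot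
«(interval ⇒ §2 description) ⇒ (interval ⇒ (2.50))» at `w.C P`; the nine in-edge antecedents are not used.  Pure logic over `Dag.B16_main`'s shape
([Balaban1989LargeFieldII] Thm 1 p. 355: the node's conclusion is `rOperation ∧ (… → uvBounds)`). [cite: Balaban1989LargeFieldII, Thm 1 p.355, p.387, p.391 (bookkeeping)] -/
theorem b16_main_of_rOperation_of_uvSlot (w : WorldP) (P : B12.RunParams) (hR : (w.up P).rOperation)
    (huv : ((leavesP w P).smallCouplings → (leavesP w P).densitiesDescribed) →
      ((leavesP w P).smallCouplings → (leavesP w P).uvBounds)) :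
    Dag.B16_main (leavesP w P) :=
  fun _ _ _ _ _ _ _ _ _ => ⟨hR, huv⟩

variable (F : T4Family) (N : ℕ) [NeZero N]

/-! ## §1. At the Stage-5 parameters `θ`: a world bound to `datumOfRecord₅ θ` — the slots read at the record's objects -/

section AtParams

variable (θ : Stage5Params F N) (w : WorldP) (P : B12.RunParams)

/-- At a world bound to the datum of record at `θ`, the interval hypothesis of the run `P` reads the FORWARD-GENERATED flow
`genFlow θ.res.βfun P.g0` ((0.18)∕(0.20) from the bare coupling with the residual β-functions; `Node00.flow_datumOfRecord₅`). [cite: Balaban1987RG1, (0.17)–(0.20) pp.255–256 (bookkeeping)] -/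
theorem smallCouplings_iff_genFlow (hC : w.C = (datumOfRecord₅ F N θ).C) :
    (leavesP w P).smallCouplings ↔ (genFlow θ.res.βfun P.g0).InInterval w.γ P.K := by
  show (w.C P).flow.InInterval w.γ P.K ↔ _
  rw [hC]
  exact Iff.rfl

/-- **N13's conclusion `uvBounds` at a world bound to the datum of record at `θ`, UNFOLDED AT THE RECORD'S OBJECTS**: for every `k ≤ K` and every gauge
field `U` on `T^{(k)}` of the `K`-th torus, `θ.res.χ P k U · exp[−(1∕g_k²)·θ.res.wilsonBG P k U − w.em(g_k)·|T₁^{(k)}|] ≤ ρ_k(U) ≤ exp[w.ep(g_k)·|T₁^{(k)}|]`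
with `g_k = genSeq θ.res.βfun P.g0 k`, `ρ_k = densOfRecord₅ θ P k` (`Node00.rho_datumOfRecord₅`) and `|T₁^{(k)}| = Fintype.card (Site (F.P P.K) k)` — (2.50) [III] ∕
(0.1) at the densities of record. [cite: Balaban1989LargeFieldII, (0.1) pp.355–356; Balaban1988Convergent, Cor. 3 (2.50) p.264] -/
theorem uvBounds_iff_densOfRecord₅ (hC : w.C = (datumOfRecord₅ F N θ).C) :
    (leavesP w P).uvBounds ↔
      ∀ k, k ≤ P.K → ∀ U : cfgOfRecord F N P.K k,
        θ.res.χ P k U * Real.exp (-(1 / (genSeq θ.res.βfun P.g0 k) ^ 2 * θ.res.wilsonBG P k U)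
            - w.em (genSeq θ.res.βfun P.g0 k) * (Fintype.card (Site (F.P P.K) k) : ℝ)) ≤ densOfRecord₅ F N θ P k U ∧
        densOfRecord₅ F N θ P k U ≤ Real.exp (w.ep (genSeq θ.res.βfun P.g0 k) * (Fintype.card (Site (F.P P.K) k) : ℝ)) := by
  show (∀ k, k ≤ P.K → ∀ U : (w.C P).Cfg k,
    B16.UVIneq (w.C P) k U (w.em ((w.C P).flow.g k)) (w.ep ((w.C P).flow.g k))) ↔ _
  rw [hC]
  refine forall_congr' fun k => forall_congr' fun _ => forall_congr' fun U => ?_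
  show B16.UVIneq ((datumOfRecord₅ F N θ).C P) k U _ _ ↔ _
  unfold B16.UVIneq
  rw [rho_datumOfRecord₅]
  exact Iff.rfl

/-- **The Cor.-3 slot of N13 at a world bound to the datum of record at `θ`, UNFOLDED AT THE RECORD'S OBJECTS**: «(couplings `genSeq θ.res.βfun P.g0 k` in
`]0, w.γ]` ⇒ `θ.res.S218 P k (ρ_k)` for all `k ≤ K`) ⇒ (the same interval hypothesis ⇒ (2.50) at the densities of record for all `k ≤ K`)». [cite: Balaban1989LargeFieldII, Thm 1 p.355 and (0.1) p.356; Balaban1988Convergent, (2.18) p.257, Cor. 3 (2.50) p.264] -/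
theorem uvSlot_iff_atRecord₅ (hC : w.C = (datumOfRecord₅ F N θ).C) :
    (((leavesP w P).smallCouplings → (leavesP w P).densitiesDescribed) →
        ((leavesP w P).smallCouplings → (leavesP w P).uvBounds)) ↔
      (((genFlow θ.res.βfun P.g0).InInterval w.γ P.K → ∀ k, k ≤ P.K → θ.res.S218 P k (densOfRecord₅ F N θ P k)) →
        ((genFlow θ.res.βfun P.g0).InInterval w.γ P.K → ∀ k, k ≤ P.K → ∀ U : cfgOfRecord F N P.K k,
          θ.res.χ P k U * Real.exp (-(1 / (genSeq θ.res.βfun P.g0 k) ^ 2 * θ.res.wilsonBG P k U)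
              - w.em (genSeq θ.res.βfun P.g0 k) * (Fintype.card (Site (F.P P.K) k) : ℝ)) ≤ densOfRecord₅ F N θ P k U ∧
          densOfRecord₅ F N θ P k U ≤ Real.exp (w.ep (genSeq θ.res.βfun P.g0 k) * (Fintype.card (Site (F.P P.K) k) : ℝ)))) := by
  rw [smallCouplings_iff_genFlow F N θ w P hC, B14NodeKnitRecord5.densitiesDescribed_iff_S218 F N θ w P hC,
    uvBounds_iff_densOfRecord₅ F N θ w P hC]

/-- **N13 AT THE STAGE-5 PARAMETERS `θ`** ([Balaban1989LargeFieldII] Thm 1 p. 355 + Cor. 3): for a world bound to the datum of record at `θ` (`hC`) whose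
upstream block at the run `P` is the record's N-binding (`hup`), `Dag.B16_main (leavesP w P)` follows from the node's two OWN products read at the
record's objects — (R₅) `hR : ROpLeaf (θ.res.V P)`, [III] p. 244's property of the RESIDUAL 𝐑-carrier (what Thm 1 delivers, pp. 356–391 with [IV]);
(UV₅) `huv`, the Cor.-3 slot at the densities of record (p. 387: *"This implies the inequality (2.50) [III], hence Corollary 3."*).  Both are
HYPOTHESES; count-neutral. [cite: Balaban1989LargeFieldII, Thm 1 p.355, p.387, p.391; Balaban1988Convergent, p.244] -/
theorem b16_main_at_stage5Params (hC : w.C = (datumOfRecord₅ F N θ).C) (hup : w.up P = upOfRecord₅ F N θ P)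
    (hR : ROpLeaf (θ.res.V P))
    (huv : ((genFlow θ.res.βfun P.g0).InInterval w.γ P.K → ∀ k, k ≤ P.K → θ.res.S218 P k (densOfRecord₅ F N θ P k)) →
      (genFlow θ.res.βfun P.g0).InInterval w.γ P.K → ∀ k, k ≤ P.K → ∀ U : cfgOfRecord F N P.K k,
        θ.res.χ P k U * Real.exp (-(1 / (genSeq θ.res.βfun P.g0 k) ^ 2 * θ.res.wilsonBG P k U)
            - w.em (genSeq θ.res.βfun P.g0 k) * (Fintype.card (Site (F.P P.K) k) : ℝ)) ≤ densOfRecord₅ F N θ P k U ∧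
        densOfRecord₅ F N θ P k U ≤ Real.exp (w.ep (genSeq θ.res.βfun P.g0 k) * (Fintype.card (Site (F.P P.K) k) : ℝ))) :
    Dag.B16_main (leavesP w P) :=
  b16_main_of_rOperation_of_uvSlot w P ((B14NodeKnitRecord5.rOperation_iff_rOpLeaf_res F N θ w P hup).2 hR)
    ((uvSlot_iff_atRecord₅ F N θ w P hC).2 huv)

/-- **(UV₅) from per-step (2.18)-representation data at the densities of record** ([III] p. 264's derivation — the two finite-sum facts
`B14Cor3.ge_of_sum_repr` ∕ `le_of_sum_repr` of `B14Cor3.uvIneq_of_termData`, here at `ρ_k = densOfRecord₅ θ P k` directly): for every step `k`, representation data `R k` of `ρ_k` on the gauge fields of `T^{(k)}` such that, under the interval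
hypothesis on the forward-generated couplings and GIVEN the §2-description guard `θ.res.S218 P k (ρ_k)`: (H) `ρ_k = Σ_a term a`, (U1) summands ≤ majorants,
(U2) `Σ_a major a ≤ exp[w.ep(g_k)|T₁^{(k)}|]`, (L1) summands ≥ 0, (L2) the all-small summand ≥ `θ.res.χ P k · exp[−g_k⁻² θ.res.wilsonBG P k − w.em(g_k)|T₁^{(k)}|]`.
With (R₅) this gives N13 at `(w, P)`.  The five leaves are the located inputs of cell GAPS G-adv3-1 ∕ G-adv3-2 — HYPOTHESES. [cite: Balaban1988Convergent, (2.18) p.257, Cor. 3 (2.50) p.264; Balaban1989LargeFieldII, p.387] -/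
theorem b16_main_at_stage5Params_of_termData (hC : w.C = (datumOfRecord₅ F N θ).C) (hup : w.up P = upOfRecord₅ F N θ P)
    (hR : ROpLeaf (θ.res.V P)) (R : (k : ℕ) → B14Cor3.TermData ((datumOfRecord₅ F N θ).C P) k)
    (hH : (genFlow θ.res.βfun P.g0).InInterval w.γ P.K → ∀ k, k ≤ P.K → θ.res.S218 P k (densOfRecord₅ F N θ P k) →
      ∀ U : cfgOfRecord F N P.K k, densOfRecord₅ F N θ P k U = ∑ a, (R k).term a U)
    (hU1 : (genFlow θ.res.βfun P.g0).InInterval w.γ P.K → ∀ k, k ≤ P.K → θ.res.S218 P k (densOfRecord₅ F N θ P k) →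
      ∀ a (U : cfgOfRecord F N P.K k), (R k).term a U ≤ (R k).major a)
    (hU2 : (genFlow θ.res.βfun P.g0).InInterval w.γ P.K → ∀ k, k ≤ P.K → θ.res.S218 P k (densOfRecord₅ F N θ P k) →
      ∑ a, (R k).major a ≤ Real.exp (w.ep (genSeq θ.res.βfun P.g0 k) * (Fintype.card (Site (F.P P.K) k) : ℝ)))
    (hL1 : (genFlow θ.res.βfun P.g0).InInterval w.γ P.K → ∀ k, k ≤ P.K → θ.res.S218 P k (densOfRecord₅ F N θ P k) →
      ∀ a (U : cfgOfRecord F N P.K k), 0 ≤ (R k).term a U)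
    (hL2 : (genFlow θ.res.βfun P.g0).InInterval w.γ P.K → ∀ k, k ≤ P.K → θ.res.S218 P k (densOfRecord₅ F N θ P k) →
      ∀ U : cfgOfRecord F N P.K k,
        θ.res.χ P k U * Real.exp (-(1 / (genSeq θ.res.βfun P.g0 k) ^ 2 * θ.res.wilsonBG P k U)
            - w.em (genSeq θ.res.βfun P.g0 k) * (Fintype.card (Site (F.P P.K) k) : ℝ)) ≤ (R k).term (R k).allSmall U) :
    Dag.B16_main (leavesP w P) := by
  refine b16_main_at_stage5Params F N θ w P hC hup hR fun hdd hsc k hk U => ?_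
  have hs : θ.res.S218 P k (densOfRecord₅ F N θ P k) := hdd hsc k hk
  refine ⟨B14Cor3.ge_of_sum_repr (fun a => (R k).term a U) (R k).allSmall (hH hsc k hk hs U) (fun a => hL1 hsc k hk hs a U)
      (hL2 hsc k hk hs U), ?_⟩
  exact B14Cor3.le_of_sum_repr (fun a => (R k).term a U) (R k).major (hH hsc k hk hs U) (fun a => hU1 hsc k hk hs a U)
    (hU2 hsc k hk hs)

/-- **(UV₅) from a representation family of the datum's construction and [III] p. 264's five leaves** (`B16NodeKnit.uvSlot_of_cor3Leaves` at
`(datumOfRecord₅ θ).C`, interval `w.γ`, exponent functions `w.ep ∕ w.em`): with (R₅), N13 at `(w, P)`. [cite: Balaban1988Convergent, Cor. 3 (2.50) p.264; Balaban1989LargeFieldII, Thm 1 p.355, p.387] -/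
theorem b16_main_at_stage5Params_of_cor3Leaves (hC : w.C = (datumOfRecord₅ F N θ).C) (hup : w.up P = upOfRecord₅ F N θ P)
    (hR : ROpLeaf (θ.res.V P)) (R : B14Cor3.ReprFamily (datumOfRecord₅ F N θ).C)
    (hH : B14Cor3.LeafH (datumOfRecord₅ F N θ).C R w.γ) (hU1 : B14Cor3.LeafU1 (datumOfRecord₅ F N θ).C R w.γ)
    (hU2 : B14Cor3.LeafU2 (datumOfRecord₅ F N θ).C R w.γ w.ep) (hL1 : B14Cor3.LeafL1 (datumOfRecord₅ F N θ).C R w.γ)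
    (hL2 : B14Cor3.LeafL2 (datumOfRecord₅ F N θ).C R w.γ w.em) :
    Dag.B16_main (leavesP w P) := by
  refine b16_main_of_rOperation_of_uvSlot w P ((B14NodeKnitRecord5.rOperation_iff_rOpLeaf_res F N θ w P hup).2 hR) ?_
  obtain ⟨C, γ, em, ep, βup, β₀, β₀_pos, b, b_pos, L, one_lt_L, gR, up⟩ := w
  cases hC
  exact B16NodeKnit.uvSlot_of_cor3Leaves _ R hH hU1 hU2 hL1 hL2 P

end AtParams

/-! ## §2. At the record predicate `IsRecordOfRecord₅ F N D w` -/

section AtRecord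

variable {F N}
variable {D : FiniteEpsData F (SU N)} {w : WorldP}

/-- **N13 AT NODE 00's STAGE-5 RECORD, KNIT BY NAME** ([Balaban1989LargeFieldII] Thm 1 p. 355 + (0.1), Cor. 3 pp. 387 ∕ 391): if `(D, w)` is a Stage-5
record (`IsRecordOfRecord₅ F N D w`) and, for the parameters of the record — every admissible `θ` with `D = datumOfRecord₅ θ` and `w.up = upOfRecord₅ θ` —
every run carries (R₅) [III] p. 244's property of the residual 𝐑-carrier `θ.res.V P` and (UV₅) the Cor.-3 slot at the densities of record (read at
`θ.res.χ ∕ wilsonBG ∕ S218`, the forward-generated couplings and the world's exponent functions), then N13 holds at every run.  Count-neutral slot landing;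
both slots are what [Balaban1989LargeFieldII] proves, HYPOTHESES here. [cite: Balaban1989LargeFieldII, Thm 1 p.355, p.387, p.391; Balaban1988Convergent, p.244, Cor. 3 (2.50) p.264] -/
theorem b16_main_of_isRecordOfRecord₅ (h : IsRecordOfRecord₅ F N D w)
    (slots : ∀ θ : Stage5Params F N, θ.Admissible → D = datumOfRecord₅ F N θ →
      (∀ P, w.up P = upOfRecord₅ F N θ P) → ∀ P : B12.RunParams,
        ROpLeaf (θ.res.V P) ∧
        (((genFlow θ.res.βfun P.g0).InInterval w.γ P.K → ∀ k, k ≤ P.K → θ.res.S218 P k (densOfRecord₅ F N θ P k)) →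
          (genFlow θ.res.βfun P.g0).InInterval w.γ P.K → ∀ k, k ≤ P.K → ∀ U : cfgOfRecord F N P.K k,
            θ.res.χ P k U * Real.exp (-(1 / (genSeq θ.res.βfun P.g0 k) ^ 2 * θ.res.wilsonBG P k U)
                - w.em (genSeq θ.res.βfun P.g0 k) * (Fintype.card (Site (F.P P.K) k) : ℝ)) ≤ densOfRecord₅ F N θ P k U ∧
            densOfRecord₅ F N θ P k U ≤ Real.exp (w.ep (genSeq θ.res.βfun P.g0 k) * (Fintype.card (Site (F.P P.K) k) : ℝ)))) :
    ∀ P : B12.RunParams, Dag.B16_main (leavesP w P) := by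
  intro P
  obtain ⟨θ, hθ, hD, hC, -, -, hup⟩ := h
  obtain ⟨hR, huv⟩ := slots θ hθ hD hup P
  exact b16_main_at_stage5Params F N θ w P (by rw [hC, hD]) (hup P) hR huv

/-- **The same with (UV₅) from [III] p. 264's five leaves** over a representation family of `D.C` on the world's interval with the world's exponent
functions (`B14Cor3.LeafH ∕ U1 ∕ U2 ∕ L1 ∕ L2`), and (R₅) for the parameters of the record. [cite: Balaban1989LargeFieldII, Thm 1 p.355, p.387; Balaban1988Convergent, p.244, Cor. 3 (2.50) p.264] -/
theorem b16_main_of_isRecordOfRecord₅_of_cor3Leaves (h : IsRecordOfRecord₅ F N D w)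
    (hR : ∀ θ : Stage5Params F N, θ.Admissible → D = datumOfRecord₅ F N θ →
      (∀ P, w.up P = upOfRecord₅ F N θ P) → ∀ P : B12.RunParams, ROpLeaf (θ.res.V P))
    (R : B14Cor3.ReprFamily D.C) (hH : B14Cor3.LeafH D.C R w.γ) (hU1 : B14Cor3.LeafU1 D.C R w.γ) (hU2 : B14Cor3.LeafU2 D.C R w.γ w.ep)
    (hL1 : B14Cor3.LeafL1 D.C R w.γ) (hL2 : B14Cor3.LeafL2 D.C R w.γ w.em) :
    ∀ P : B12.RunParams, Dag.B16_main (leavesP w P) := by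
  intro P
  obtain ⟨θ, hθ, hD, hC, -, -, hup⟩ := h
  have hR' : ROpLeaf (θ.res.V P) := hR θ hθ hD hup P
  subst hD
  exact b16_main_at_stage5Params_of_cor3Leaves F N θ w P hC (hup P) hR' R hH hU1 hU2 hL1 hL2

/-- **The `S_N13 Rec₅` shape**: `∀ D w, IsRecordOfRecord₅ F N D w → ∀ P, Dag.B16_main (leavesP w P)` from the two slots stated ONCE over all admissible
parameters `θ` at the worlds carrying the record's construction and N-binding — the form a `stub_N13` typed over the Stage-5 record predicate takes (R422;
dagwriter `YMDAG.UVSplit.S_N13`).  (Design note, kernel: such worlds carry ARBITRARY exponent functions `w.em, w.ep` — module 4 `B16NodeKnitExponents` shows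
the unquantified shape is then junk-refutable wherever N13's antecedents hold with `ρ_k > 0`; the design-E shape of §3 is the repaired child.) [cite: Balaban1989LargeFieldII, Thm 1 p.355 + p.391 (bookkeeping)] -/
theorem b16_main_forall_isRecordOfRecord₅
    (slots : ∀ θ : Stage5Params F N, θ.Admissible → ∀ w : WorldP, w.C = (datumOfRecord₅ F N θ).C →
      (∀ P, w.up P = upOfRecord₅ F N θ P) → ∀ P : B12.RunParams,
        ROpLeaf (θ.res.V P) ∧
        (((genFlow θ.res.βfun P.g0).InInterval w.γ P.K → ∀ k, k ≤ P.K → θ.res.S218 P k (densOfRecord₅ F N θ P k)) →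
          (genFlow θ.res.βfun P.g0).InInterval w.γ P.K → ∀ k, k ≤ P.K → ∀ U : cfgOfRecord F N P.K k,
            θ.res.χ P k U * Real.exp (-(1 / (genSeq θ.res.βfun P.g0 k) ^ 2 * θ.res.wilsonBG P k U)
                - w.em (genSeq θ.res.βfun P.g0 k) * (Fintype.card (Site (F.P P.K) k) : ℝ)) ≤ densOfRecord₅ F N θ P k U ∧
            densOfRecord₅ F N θ P k U ≤ Real.exp (w.ep (genSeq θ.res.βfun P.g0 k) * (Fintype.card (Site (F.P P.K) k) : ℝ)))) :
    ∀ (D : FiniteEpsData F (SU N)) (w : WorldP), IsRecordOfRecord₅ F N D w →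
      ∀ P : B12.RunParams, Dag.B16_main (leavesP w P) := by
  intro D w h P
  obtain ⟨θ, hθ, hD, hC, -, -, hup⟩ := h
  obtain ⟨hR, huv⟩ := slots θ hθ w (by rw [hC, hD]) hup P
  exact b16_main_at_stage5Params F N θ w P (by rw [hC, hD]) (hup P) hR huv

/-- **The `S_N13 Rec₅` shape from the five Cor.-3 leaves**: (R₅) for every admissible `θ` and run, and for every admissible `θ`, every interval constant
`γ` and every pair of exponent functions `e₋ e₊` a representation family of `(datumOfRecord₅ θ).C` with [III] p. 264's five leaves at `(γ, e₋, e₊)` — the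
leaves must be supplied for EVERY `γ > 0` and EVERY `e∓` because the record predicate pins neither (`isRecordOfRecord₅_withGamma`, `isRecordOfRecord₅_reExp`):
the honest price of the unquantified shape. [cite: Balaban1989LargeFieldII, Thm 1 p.355 + p.391; Balaban1988Convergent, Cor. 3 (2.50) p.264 (bookkeeping)] -/
theorem b16_main_forall_isRecordOfRecord₅_of_cor3Leaves
    (hR : ∀ θ : Stage5Params F N, θ.Admissible → ∀ P : B12.RunParams, ROpLeaf (θ.res.V P))
    (hcor : ∀ θ : Stage5Params F N, θ.Admissible → ∀ (γ : ℝ) (em ep : ℝ → ℝ),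
      ∃ R : B14Cor3.ReprFamily (datumOfRecord₅ F N θ).C,
        B14Cor3.LeafH (datumOfRecord₅ F N θ).C R γ ∧ B14Cor3.LeafU1 (datumOfRecord₅ F N θ).C R γ ∧
        B14Cor3.LeafU2 (datumOfRecord₅ F N θ).C R γ ep ∧ B14Cor3.LeafL1 (datumOfRecord₅ F N θ).C R γ ∧
        B14Cor3.LeafL2 (datumOfRecord₅ F N θ).C R γ em) :
    ∀ (D : FiniteEpsData F (SU N)) (w : WorldP), IsRecordOfRecord₅ F N D w →
      ∀ P : B12.RunParams, Dag.B16_main (leavesP w P) := by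
  intro D w h P
  obtain ⟨θ, hθ, hD, hC, -, -, hup⟩ := h
  obtain ⟨R, hH, hU1, hU2, hL1, hL2⟩ := hcor θ hθ w.γ w.em w.ep
  exact b16_main_at_stage5Params_of_cor3Leaves F N θ w P (by rw [hC, hD]) (hup P) (hR θ hθ P) R hH hU1 hU2 hL1 hL2

end AtRecord

/-! ## §3. Design E: [III] Cor. 3's exponents existential AT THE DATUM (`S_N13E Rec₅` shape) — and what the record predicate does not read -/

section DesignE

variable {F N}
variable {D : FiniteEpsData F (SU N)} {w : WorldP}

/-- The density tower of record does not read the interval constant `γ` of the parameters (only the residual objects `E`, `R` through the Wilson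
start and the step `ρ_{k+1} = R_k(T_k ρ_k)`). [cite: Balaban1988Convergent, (0.2) p.244 (bookkeeping)] -/
theorem densOfRecord₅_withGamma (θ : Stage5Params F N) (γ : ℝ) :
    densOfRecord₅ F N { θ with γ := γ } = densOfRecord₅ F N θ := by
  funext p k
  induction k with
  | zero => rfl
  | succ k ih => simp only [densOfRecord₅, ih]

/-- Hence re-lettering the interval constant of the parameters does not change the datum of record (the machine of record reads the residual
objects only) … [cite: Balaban1988Convergent, (0.2) p.244; Balaban1987RG1, (0.17)–(0.20) pp.255–256 (bookkeeping)] -/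
theorem datumOfRecord₅_withGamma (θ : Stage5Params F N) (γ : ℝ) :
    datumOfRecord₅ F N { θ with γ := γ } = datumOfRecord₅ F N θ := by
  have hd : densOfRecord₅ F N { θ with γ := γ } = densOfRecord₅ F N θ := densOfRecord₅_withGamma θ γ
  unfold datumOfRecord₅ machineOfRecord₅
  rw [hd]

/-- … nor the upstream block of record (`rfl`). [cite: Balaban1989LargeFieldII, Thm 1 p.355 (bookkeeping)] -/
theorem upOfRecord₅_withGamma (θ : Stage5Params F N) (γ : ℝ) (P : B12.RunParams) :
    upOfRecord₅ F N { θ with γ := γ } P = upOfRecord₅ F N θ P := rfl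

/-- **The Stage-5 record predicate does not read the exponent functions**: re-lettering `w.em, w.ep` preserves `IsRecordOfRecord₅ F N D w` (same parameters
`θ`).  ([III] Cor. 3 p. 264: the constants `E₋, E₊` are the node's CONCLUSION letters, *"depending on g_k"*; the dagwriter's `Reletterable`, `e∓`-part.) [cite: Balaban1988Convergent, Cor. 3 (2.50) p.264 (bookkeeping)] -/
theorem isRecordOfRecord₅_reExp (h : IsRecordOfRecord₅ F N D w) (em ep : ℝ → ℝ) :
    IsRecordOfRecord₅ F N D { w with em := em, ep := ep } := by
  obtain ⟨θ, hθ, hD, hC, hγ, hL, hup⟩ := h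
  exact ⟨θ, hθ, hD, hC, hγ, hL, hup⟩

/-- **Nor does it read the VALUE of the interval constant given the datum**: `θ.γ` enters neither `datumOfRecord₅ θ` nor `upOfRecord₅ θ`, so for every
`γ > 0` the world `{w with γ := γ}` is again a Stage-5 record over the SAME datum (parameters `{θ with γ := γ}`).  Kernel fact for the planners (design E,
`S_N13E`): over one datum the record worlds carry EVERY positive interval constant, so exponent functions chosen after the datum must serve all `γ > 0`.
[cite: Balaban1989LargeFieldII, Thm 1 p.355 («sufficiently small positive γ» — a letter the Stage-5 predicate quantifies, not pins; bookkeeping)] -/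
theorem isRecordOfRecord₅_withGamma (h : IsRecordOfRecord₅ F N D w) (γ : ℝ) (hγ : 0 < γ) :
    IsRecordOfRecord₅ F N D { w with γ := γ } := by
  obtain ⟨θ, hθ, hD, hC, -, hL, hup⟩ := h
  exact ⟨{ θ with γ := γ }, ⟨hθ.1, hγ⟩, hD.trans (datumOfRecord₅_withGamma θ γ).symm, hC, rfl, hL,
    fun P => (hup P).trans (upOfRecord₅_withGamma θ γ P).symm⟩

/-- Re-lettering both: exponents and interval constant. [cite: Balaban1989LargeFieldII, Thm 1 p.355; Balaban1988Convergent, Cor. 3 p.264 (bookkeeping)] -/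
theorem isRecordOfRecord₅_withGamma_reExp (h : IsRecordOfRecord₅ F N D w) (γ : ℝ) (hγ : 0 < γ) (em ep : ℝ → ℝ) :
    IsRecordOfRecord₅ F N D { w with γ := γ, em := em, ep := ep } :=
  isRecordOfRecord₅_reExp (isRecordOfRecord₅_withGamma h γ hγ) em ep

/-- **N13 AT THE RE-LETTERED RECORD WORLD** (design E, one world): if `(D, w)` is a Stage-5 record and, for datum-indexed exponent families `e₋ e₊` (chosen
after the datum — [III] Cor. 3's *"constants E₋, E₊ independent of η and T, but depending on g_k"*), every parameter `θ` of the datum carries (R₅) at every run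
and a representation family of `(datumOfRecord₅ θ).C` with [III] p. 264's five leaves at `(w.γ, eM D, eP D)`, then N13 holds at every run of the record world
`{w with em := eM D, ep := eP D}` (itself a record, `isRecordOfRecord₅_reExp`). [cite: Balaban1989LargeFieldII, Thm 1 p.355, p.387, p.391; Balaban1988Convergent, Cor. 3 (2.50) p.264] -/
theorem b16_main_reExp_of_isRecordOfRecord₅ (eM eP : FiniteEpsData F (SU N) → ℝ → ℝ) (h : IsRecordOfRecord₅ F N D w)
    (hR : ∀ θ : Stage5Params F N, θ.Admissible → D = datumOfRecord₅ F N θ → ∀ P : B12.RunParams, ROpLeaf (θ.res.V P))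
    (hcor : ∀ θ : Stage5Params F N, θ.Admissible → D = datumOfRecord₅ F N θ →
      ∃ R : B14Cor3.ReprFamily (datumOfRecord₅ F N θ).C,
        B14Cor3.LeafH (datumOfRecord₅ F N θ).C R w.γ ∧ B14Cor3.LeafU1 (datumOfRecord₅ F N θ).C R w.γ ∧
        B14Cor3.LeafU2 (datumOfRecord₅ F N θ).C R w.γ (eP D) ∧ B14Cor3.LeafL1 (datumOfRecord₅ F N θ).C R w.γ ∧
        B14Cor3.LeafL2 (datumOfRecord₅ F N θ).C R w.γ (eM D)) :
    ∀ P : B12.RunParams, Dag.B16_main (leavesP { w with em := eM D, ep := eP D } P) := by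
  intro P
  obtain ⟨θ, hθ, hD, hC, -, -, hup⟩ := h
  obtain ⟨R, hH, hU1, hU2, hL1, hL2⟩ := hcor θ hθ hD
  have hR' : ROpLeaf (θ.res.V P) := hR θ hθ hD P
  exact b16_main_at_stage5Params_of_cor3Leaves F N θ { w with em := eM D, ep := eP D } P (by rw [← hD]; exact hC) (hup P)
    hR' R hH hU1 hU2 hL1 hL2

/-- **THE `S_N13E Rec₅` SHAPE** (dagwriter g80 `YMDAG.UVSplit.S_N13E`, plan g60 ∕ chair R430 design E: *"for every family with a record datum there EXIST
dependence functions `e₋, e₊` such that node N13 holds at every run of every record world over that datum carrying them"*): from datum-indexed exponent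
families `e₋ e₊` with, for every admissible parameter `θ`: (R₅) at every run, and for EVERY interval constant `γ` a representation family of
`(datumOfRecord₅ θ).C` with [III] p. 264's five leaves at `(γ, e₋ (datumOfRecord₅ θ), e₊ (datumOfRecord₅ θ))` («every γ»: `isRecordOfRecord₅_withGamma`).
Witness: `e∓ D`.  Every displayed hypothesis is what [Balaban1989LargeFieldII] proves — Thm 1 for 𝐑, Cor. 3 via (1.89)-improved and the (1.90) gas
(`B16Cor3CurlyGas` is the typed one-run-one-step derivation) — HYPOTHESES here; count-neutral. [cite: Balaban1989LargeFieldII, Thm 1 p.355, p.387, p.391; Balaban1988Convergent, p.244, Cor. 3 (2.50) p.264] -/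
theorem s_N13E_shape_of_slots₅ (eM eP : FiniteEpsData F (SU N) → ℝ → ℝ)
    (hR : ∀ θ : Stage5Params F N, θ.Admissible → ∀ P : B12.RunParams, ROpLeaf (θ.res.V P))
    (hcor : ∀ θ : Stage5Params F N, θ.Admissible → ∀ γ : ℝ,
      ∃ R : B14Cor3.ReprFamily (datumOfRecord₅ F N θ).C,
        B14Cor3.LeafH (datumOfRecord₅ F N θ).C R γ ∧ B14Cor3.LeafU1 (datumOfRecord₅ F N θ).C R γ ∧
        B14Cor3.LeafU2 (datumOfRecord₅ F N θ).C R γ (eP (datumOfRecord₅ F N θ)) ∧ B14Cor3.LeafL1 (datumOfRecord₅ F N θ).C R γ ∧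
        B14Cor3.LeafL2 (datumOfRecord₅ F N θ).C R γ (eM (datumOfRecord₅ F N θ))) :
    ∀ D : FiniteEpsData F (SU N), (∃ w : WorldP, IsRecordOfRecord₅ F N D w) →
      ∃ em ep : ℝ → ℝ, ∀ w : WorldP, IsRecordOfRecord₅ F N D w → w.em = em → w.ep = ep →
        ∀ P : B12.RunParams, Dag.B16_main (leavesP w P) := by
  intro D _
  refine ⟨eM D, eP D, fun w h hem hep P => ?_⟩
  obtain ⟨θ, hθ, hD, hC, -, -, hup⟩ := h
  obtain ⟨R, hH, hU1, hU2, hL1, hL2⟩ := hcor θ hθ w.γ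
  subst hD
  rw [← hem] at hL2
  rw [← hep] at hU2
  exact b16_main_at_stage5Params_of_cor3Leaves F N θ w P hC (hup P) (hR θ hθ P) R hH hU1 hU2 hL1 hL2

/-- **Design E with the interval constant ALSO chosen at the datum** (the reading in which [III] Cor. 3's *"under the assumptions of Theorem 1"* fixes `γ`
before `E∓`): exponent families indexed by the datum AND the interval constant, `e∓ D γ`, with the five leaves at `(γ, eM D γ, eP D γ)` for every parameter of
`D`, give `∀ D γ, … ∃ em ep, ∀ w, Rec₅ D w → w.γ = γ → w.em = em → w.ep = ep → ∀ P, N13` — the variant a planner may prefer if the leaves are only available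
for small `γ` (then with `e∓ D γ` arbitrary off the small range).  Located alternative, not a recommendation. [cite: Balaban1989LargeFieldII, Thm 1 p.355; Balaban1988Convergent, Cor. 3 (2.50) p.264 (bookkeeping)] -/
theorem s_N13E_shape_of_slots₅_gamma (eM eP : FiniteEpsData F (SU N) → ℝ → ℝ → ℝ)
    (hR : ∀ θ : Stage5Params F N, θ.Admissible → ∀ P : B12.RunParams, ROpLeaf (θ.res.V P))
    (hcor : ∀ θ : Stage5Params F N, θ.Admissible → ∀ γ : ℝ,
      ∃ R : B14Cor3.ReprFamily (datumOfRecord₅ F N θ).C,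
        B14Cor3.LeafH (datumOfRecord₅ F N θ).C R γ ∧ B14Cor3.LeafU1 (datumOfRecord₅ F N θ).C R γ ∧
        B14Cor3.LeafU2 (datumOfRecord₅ F N θ).C R γ (eP (datumOfRecord₅ F N θ) γ) ∧ B14Cor3.LeafL1 (datumOfRecord₅ F N θ).C R γ ∧
        B14Cor3.LeafL2 (datumOfRecord₅ F N θ).C R γ (eM (datumOfRecord₅ F N θ) γ)) :
    ∀ (D : FiniteEpsData F (SU N)) (γ : ℝ),
      ∃ em ep : ℝ → ℝ, ∀ w : WorldP, IsRecordOfRecord₅ F N D w → w.γ = γ → w.em = em → w.ep = ep →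
        ∀ P : B12.RunParams, Dag.B16_main (leavesP w P) := by
  intro D γ
  refine ⟨eM D γ, eP D γ, fun w h hγ hem hep P => ?_⟩
  obtain ⟨θ, hθ, hD, hC, -, -, hup⟩ := h
  obtain ⟨R, hH, hU1, hU2, hL1, hL2⟩ := hcor θ hθ γ
  subst hD
  subst hγ
  rw [← hem] at hL2
  rw [← hep] at hU2
  exact b16_main_at_stage5Params_of_cor3Leaves F N θ w P hC (hup P) (hR θ hθ P) R hH hU1 hU2 hL1 hL2

end DesignE

end Literature.MathematicalPhysics.QuantumFieldTheory.Balaban1983to89.B16NodeKnitRecord5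

end
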